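import Literature.MathematicalPhysics.QuantumFieldTheory.Balaban1983to89.B8LeafModelZd
import Literature.MathematicalPhysics.QuantumFieldTheory.Balaban1983to89.B8Prop6OfThm4

/-!
# `Balaban1983to89.B8LeafModelZdBoundary` — [Balaban1985RegularSpaces] THEOREM 2 (p. 83) IS FALSE ON THE GENERAL-BACKGROUND PROTOTYPE
# FAMILY `B8LeafModelZd.zdGF` (g4) AS INDEXED BY ALL OF `ZdIdx`: the Ω₀-BOUNDARY LAYER (pin hazard №6 of `B8-PIN-DESIGN-g5.md`)

statement-level skeleton of published theorems with citation tags; proofs where landed; nothing here is a claim about the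
Yang–Mills mass gap

PDF held: `paper:balaban1985-cmp99-regular-spaces-gauge-fixing` (journal page = PDF page + 74); p. 77 ((1.3)–(1.6), the bond convention,
«we admit the case where some domains Ω_j are equal to T_η»), pp. 82–83 ((1.33)–(1.39), Theorem 2).

WHY THIS FILE (cell `pub-ymgap`, seat `pub-ymgap-dag-n05-a` g5, KNIT seat of DAG node N05 = [B8]; count-neutral; a LOCATED NEGATIVE for
the pin, in the `B8LeafKnit.not_b8LeafR_halfspace` pattern).  The leaf conjunct `t2 := B8.Thm2Printed fam` must be instantiated on the B8 family
of record (NODE 00 Stage 3′).  The prototype `zdGF 𝔸 L i` (`i : ZdIdx d L`: ANY antitone region sequence `Ω` with towers, gauge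
transformations CARRIED BY `Ω 0` — hazard №3's repair of print's «exactly one u» —, (1.36)/(1.62) read on the sides of the plaquettes
touching `Ω_j`) admits members with `Ω 0 ≠ ℤᵈ`, and on such a member Theorem 2's typed sentence FAILS: with `U₀ := 1` and `U′ :=` the pure
gauge of `1` by `−1` at ONE exterior site `c ∉ Ω 0` adjacent to `v ∈ Ω 0`, the hypotheses (1.33) (`B8Prop6OfThm4.one_inAk`), (1.34)
(gauge invariance `B8Ineq132.inAk_gaugeAct_iff`; the axial clause vacuous) and (1.35) (vacuous on this member) hold for EVERY `α₀, α₁ > 0`,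
while any admissible `u` has `u c = 1` (carried by `Ω 0`) and `u v = 1` ((1.29) at level 0, `restr129_level_zero`), so
`(U′^{u⁻¹})_(v,c) = −1`, contradicting (1.36)₁ `‖(1/iη) log(U′^{u⁻¹})_(v,c)‖ ≤ B₁(α₀+α₁)η⁻¹` for `B₁(α₀ + α₁) ≤ 1/16`
(`B8Prop3GaugeFixedKLevel.norm_cfgExp_sub_one_le`: `‖e^{iηA} − 1‖ ≤ 1/8 < 2 = ‖−1 − 1‖`).  The member used is the MINIMAL one
(`Ω 0 = {0}`, `k = 1`, `η = 1`, one level-0 tower, no constraint bonds) — legal in `ZdIdx`; the mechanism is the same for every member with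
an exterior site adjacent to `Ω 0` (desk note §3).  CONSEQUENCE FOR THE PIN: the B8 family of record must be indexed by sequences with
`Ω 0 = univ` (print p. 77 admits `Ω_j = T_η`), where `GT` = all unitary gauge transformations and the boundary layer is empty; Theorem 4
(`thm4Printed_zd`) is NOT affected (its hypothesis (1.66)₀ on `E 0` excludes this `U′`).

WHAT IS PROVED (kernel, 0 sorry, theorems only; two private helpers `norm_neg_one_sub_one`, `neg_one_mem_unitaryUnits`):
**`not_thm2Printed_zdGF : ¬ B8.Thm2Printed (fun i : ZdIdx d L => zdGF 𝔸 L i)`** (`d ≥ 2`, `L ≥ 1`).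

HONEST SCOPE.  A statement about the TYPING of the prototype family (which members the index admits), not about Bałaban's Theorem 2 on
his admissible sequences (1.4) with his gauge group; nothing of print is refuted.  Count-neutral; N05 NOT discharged; nothing continuum /
ℝ⁴ / OS / mass-gap / Clay.  Unit `pub-ymgap-dag-n05-a` (g5), 2026-08-26.
-/

noncomputable section

open NormedSpace

namespace Literature.MathematicalPhysics.QuantumFieldTheory.Balaban1983to89.B8LeafModelZdBoundary

open Complex (I)
open MatrixLog B7Prop1Explicit B7Prop2Explicit B7Prop1Local B7Eq92Concrete
open B8Ineq132 (InAk BondTouches)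
open B8Eq119TwistedAxial (Restr129 InAx restr129_level_zero)
open B8Eq184Proof (cfgExp)
open B8Lemma1NonAbelian (mulCfg)
open B8Eq140Level (SideTouches)
open B8Ineq130 (tlo thi)
open B8Eq138LandauZd (logCfg)
open B8Prop3GaugeFixedKLevel (norm_cfgExp_sub_one_le)
open B8LeafModelZd (ZdIdx zdGF)

-- `Site` alone could resolve to the torus sites of `Setup.lean`; re-export the `ℤ^d` sites of `B7Prop1Explicit`.
export B7Prop1Explicit (Site)

variable {d : ℕ}

section Algebra

variable {𝔸 : Type*} [CStarAlgebra 𝔸] [Nontrivial 𝔸]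

/-- `‖−1 − 1‖ = 2` in a nontrivial C⋆-algebra. [folklore] -/
private theorem norm_neg_one_sub_one : ‖(-1 : 𝔸) - 1‖ = 2 := by
  have h : (-1 : 𝔸) - 1 = -((2 : ℝ) • (1 : 𝔸)) := by
    rw [two_smul]; abel
  rw [h, norm_neg, norm_smul, norm_one, mul_one, Real.norm_eq_abs, abs_of_pos (by norm_num : (0 : ℝ) < 2)]

omit [Nontrivial 𝔸] in
/-- `−1` is a unitary unit. [folklore] -/
private theorem neg_one_mem_unitaryUnits : (-1 : 𝔸ˣ) ∈ unitaryUnits 𝔸 := by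
  rw [mem_unitaryUnits, Units.val_neg, Units.val_one]
  exact Unitary.mem_iff.mpr ⟨by simp, by simp⟩

end Algebra

section Refutation

variable {𝔸 : Type} [CStarAlgebra 𝔸] [Nontrivial 𝔸]

/-- **THEOREM 2's typed sentence is FALSE on the prototype family `zdGF` indexed by all of `ZdIdx`** (`d ≥ 2`, `L ≥ 1`): the member with
`Ω 0 = {0}`, one level-0 tower at `0`, `k = 1`, `η = 1`, no constraint bonds, and the data `U₀ = 1`, `U′ =` the pure gauge of `1` by `−1` at
the exterior site `e₀ ∉ Ω 0` refute it — (1.33)/(1.34)/(1.35) hold for every `α₀, α₁ > 0`, every admissible `u` is `1` at `0` and at `e₀`,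
and `(U′^{u⁻¹})_(0,e₀) = −1` violates (1.36)₁ at the bond `(0, e₀) ∈ E 0` once `B₁(α₀ + α₁) ≤ 1/16`.  See the module docstring (pin hazard
№6: the family of record needs `Ω 0 = univ`). [cite: Balaban1985RegularSpaces, Thm 2 p.83, (1.33)–(1.36) p.82, p.77 (bond convention; «Ω_j = T_η» admitted)] -/
theorem not_thm2Printed_zdGF (hd2 : 2 ≤ d) {L : ℕ} (hL : 1 ≤ L) :
    ¬ B8.Thm2Printed (fun i : ZdIdx d L => zdGF 𝔸 L i) := by
  classical
  rintro ⟨B₁, B₂, c₁, hB₁, -, hc₁, H⟩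
  have hd0 : 0 < d := by omega
  set μ₀ : Fin d := ⟨0, hd0⟩ with hμ₀
  set v : Site d := 0 with hv
  set c : Site d := e μ₀ with hc
  have hcv : c ≠ v := by
    intro h
    have := congrArg (fun x : Site d => x μ₀) h
    simp [hc, hv, e_apply] at this
  -- the minimal member
  let i₀ : ZdIdx d L :=
    { η := 1
      hη := one_pos
      k := 1
      hk := le_rfl
      Ω := fun j => {x | x = v ∧ j = 0}
      hΩ := fun j x hx => by simp at hx
      Λs := fun _ j => {x | x = v ∧ j = 0}
      Λb := fun _ _ => ∅
      hbox := fun m _ j _ c hc => by simp at hc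
      hclass := fun m _ j _ c hc => by simp at hc
      htower := by
        rintro j - y ⟨rfl, rfl⟩ x hx
        refine ⟨funext fun i => le_antisymm (hx i).2 (hx i).1, rfl⟩
      hpart := by
        rintro x ⟨rfl, -⟩
        exact ⟨0, Nat.zero_le _, v, ⟨rfl, rfl⟩, fun i => ⟨le_rfl, le_rfl⟩⟩ }
  -- the smallness parameters
  set α : ℝ := min (c₁ / 2) (1 / (32 * B₁)) with hα_def
  have hα : 0 < α := lt_min (by linarith) (by positivity)
  have hαc : α + α ≤ c₁ := by
    have : α ≤ c₁ / 2 := min_le_left _ _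
    linarith
  have hαB : B₁ * (α + α) ≤ 1 / 16 := by
    have h1 : α ≤ 1 / (32 * B₁) := min_le_right _ _
    have h2 : B₁ * α ≤ B₁ * (1 / (32 * B₁)) := mul_le_mul_of_nonneg_left h1 hB₁.le
    have h3 : B₁ * (1 / (32 * B₁)) = 1 / 32 := by field_simp
    linarith
  -- the data: `U₀ = 1`, `U′` = pure gauge by `−1` at `c`
  set g : Site d → 𝔸ˣ := Function.update 1 c (-1) with hg_def
  have hgc : g c = -1 := by simp [hg_def]
  have hgv : g v = 1 := by simp [hg_def, hcv.symm]
  have hgU : ∀ x, g x ∈ unitaryUnits 𝔸 := by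
    intro x
    by_cases hx : x = c
    · rw [hx, hgc]; exact neg_one_mem_unitaryUnits
    · rw [hg_def, Function.update_of_ne hx]; exact (unitaryUnits 𝔸).one_mem
  have hg1 : ∀ x, g x ∈ U1 𝔸 := fun x => unitaryUnits_le_U1 (hgU x)
  set U' : Site d → Fin d → 𝔸ˣ := gaugeAct g 1 with hU'_def
  have hU'u : ∀ x κ, U' x κ ∈ unitaryUnits 𝔸 := fun x κ =>
    (unitaryUnits 𝔸).mul_mem ((unitaryUnits 𝔸).mul_mem (hgU x) (unitaryUnits 𝔸).one_mem) ((unitaryUnits 𝔸).inv_mem (hgU _))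
  have hvc : v + e μ₀ = c := by simp [hv, hc]
  have hU'vc : U' v μ₀ = -1 := by
    simp only [hU'_def, gaugeAct, hvc, hgv, hgc, Pi.one_apply, one_mul, mul_one]
    exact inv_neg_one
  have h1u : ∀ x κ, (1 : Site d → Fin d → 𝔸ˣ) x κ ∈ unitaryUnits 𝔸 := fun _ _ => (unitaryUnits 𝔸).one_mem
  let U₀ : (zdGF 𝔸 L i₀).Cfg := ⟨1, h1u⟩
  let P : (zdGF 𝔸 L i₀).Pert := (⟨1, h1u⟩, ⟨U', hU'u⟩)
  -- the hypotheses (1.33), (1.34), (1.35) at (α, α)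
  have hmul : mulCfg U' (1 : Site d → Fin d → 𝔸ˣ) = gaugeAct g 1 := by
    rw [B8Thm4Concrete.mulCfg_eq_mul, mul_one]
  have hInA : (zdGF 𝔸 L i₀).InA α U₀ := B8Prop6OfThm4.one_inAk hL 1 one_pos hα _
  have hInAAx : (zdGF 𝔸 L i₀).InAAx α U₀ P := by
    refine ⟨rfl, ?_, ?_⟩
    · show InAk L 1 1 α i₀.Ω (mulCfg U' 1)
      rw [hmul]
      exact (B8Ineq132.inAk_gaugeAct_iff L 1 1 α i₀.Ω hg1 _).2 (B8Prop6OfThm4.one_inAk hL 1 one_pos hα _)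
    · rintro m - j hj1 - xj ⟨-, hj0⟩
      omega
  have havg : (zdGF 𝔸 L i₀).avgClose α U₀ P := by
    intro j _ z μ hbox
    exfalso
    have hLj : (1 : ℤ) ≤ (L : ℤ) ^ j := one_le_pow₀ (by exact_mod_cast hL)
    have hlo : InBox (loK L j z) (bondHiK L j z μ) (loK L j z) := fun i => by
      simp only [loK, bondHiK]; split_ifs <;> omega
    have hhi : InBox (loK L j z) (bondHiK L j z μ) (fun i => (L : ℤ) ^ j * z i + if i = μ then (L : ℤ) ^ j else 0) := fun i => by
      simp only [loK, bondHiK]; split_ifs <;> omega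
    obtain ⟨h₁, -⟩ := hbox _ hlo
    obtain ⟨h₂, -⟩ := hbox _ hhi
    have := congrArg (fun x : Site d => x μ) (h₂.trans h₁.symm)
    simp [loK] at this
    omega
  -- Theorem 2's conclusion at this datum
  obtain ⟨u, hR, ⟨h136, -, -, -⟩, -⟩ := H i₀ α α hα hα hαc U₀ P hInA trivial hInAAx havg
  -- `u = 1` at `v` ((1.29) at level 0) and at `c` (carried by `Ω 0`)
  have huv : u.1 v = 1 := Units.ext (restr129_level_zero hR (y := v) ⟨rfl, rfl⟩)
  have huc : u.1 c = 1 := u.2.2 c fun h => hcv h.1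
  have huc' : u.1 (v + e μ₀) = 1 := by rw [hvc]; exact huc
  -- the gauge-fixed bond variable at `(v, c)` is `−1`
  have hside : SideTouches (i₀.Ω 0) v μ₀ := by
    haveI : Nontrivial (Fin d) := Fin.nontrivial_iff_two_le.mpr hd2
    obtain ⟨κ, hκ⟩ := exists_ne μ₀
    exact B8Eq140Level.sideTouches_of_bondTouches hκ (Or.inl ⟨rfl, rfl⟩)
  obtain ⟨hexp, -, hbd, -⟩ := h136 0 (Nat.zero_le _) (v, μ₀) hside
  have hW : ((zdGF 𝔸 L i₀).act P u).2.1 v μ₀ = -1 := by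
    show mgauge (1 : Site d → Fin d → 𝔸ˣ) u.1⁻¹ U' v μ₀ = -1
    simp only [mgauge_apply, Pi.inv_apply, Pi.one_apply, huv, huc', inv_one, one_mul, Rc_one_apply, mul_one, hU'vc]
  have hexp' : (((cfgExp 1 (logCfg 1 ((zdGF 𝔸 L i₀).act P u).2.1) v μ₀ : 𝔸ˣ)) : 𝔸) = -1 := by
    have h := congrArg (fun w : 𝔸ˣ => (w : 𝔸)) hexp
    simp only at h
    rw [← h, hW, Units.val_neg, Units.val_one]
  have hbd' : ‖logCfg 1 ((zdGF 𝔸 L i₀).act P u).2.1 v μ₀‖ ≤ B₁ * (α + α) * (1 : ℝ)⁻¹ := by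
    have h : ‖logCfg 1 ((zdGF 𝔸 L i₀).act P u).2.1 v μ₀‖ ≤ B₁ * (α + α) * ((L : ℝ) ^ 0 * 1)⁻¹ := hbd
    simpa only [pow_zero, one_mul] using h
  have hsmall := norm_cfgExp_sub_one_le (d := d) one_pos hbd' hαB
  rw [hexp', norm_neg_one_sub_one] at hsmall
  norm_num at hsmall

end Refutation

#print axioms not_thm2Printed_zdGF

end Literature.MathematicalPhysics.QuantumFieldTheory.Balaban1983to89.B8LeafModelZdBoundary

end
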